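import Literature.NumberTheory.Automorphic.BCDTModularity
import Literature.NumberTheory.GaloisRepresentations.FramedRepTwist
import Literature.NumberTheory.EllipticCurves.TateModuleTwistTransportProofs
import Literature.NumberTheory.EllipticCurves.QuadraticBaseChangeGaloisProofs
import HarnessLib

/-!
# Framed mod-`p` representations of a quadratic twist: `E^{(d)}[p] ≅ ρ̄_{E,p} ⊗ χ_d`

Topic `Literature/NumberTheory/EllipticCurves` (theorems only; nothing is defined, no named fact
is used).  For a Weierstrass curve `W` over a field `F` with `2 ≠ 0`, `d ∈ F^*`, and the
quadratic character `χ_d : Γ_F → {±1}` of `F(√d)/F` (`σ√d = χ_d(σ)√d`):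

* `WeierstrassCurve.exists_addEquiv_geomPoints_quadraticTwist_sqrt` — the isomorphism
  `f : E^{(d)}(F̄) ≃+ E(F̄)` of Silverman *AEC* X.5 Cor. 5.4 with its sign KEYED to `√d`:
  `f(σP) = σ f(P)` when `σ√d = √d` and `f(σP) = -σ f(P)` when `σ√d = -√d` (the tree's
  `exists_addEquiv_geomPoints_quadraticTwist_signed`, `OpenImageMazurTwistProofs`, records only
  the dichotomy; same construction);
* `exists_continuousQuadraticCharacter` — `χ_d` as a CONTINUOUS character `Γ_F →ₜ* kˣ` into the
  units of any topological commutative ring (the tree's `exists_quadraticCharacter` made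
  continuous: it is constant on the cosets of the open subgroup `Γ_{F(√d)}`,
  `isOpen_stabilizer_geomSqrt`);
* `isTorsionGaloisRep_twist_of_addEquiv_signed` — transport of framed models of the `p`-torsion
  along an additive isomorphism `E'(F̄) ≃+ E(F̄)` that is `Γ_F`-equivariant up to the sign `χ(σ)`:
  a frame `E[p] ≃ 𝔽_p²` with matrices `ρ̄` gives a frame of `E'[p]` with matrices `ρ̄ ⊗ χ`
  (`FramedRep.twist`);
* `isTorsionGaloisRep_quadraticTwist_twist`, `isTorsionGaloisRep_of_quadraticTwist_twist`,
  `exists_quadraticCharacter_isTorsionGaloisRep_quadraticTwist_iff` — **if `ρ̄` is a framed model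
  of `E[p]` then `ρ̄ ⊗ χ_d` is a framed model of `E^{(d)}[p]`, and conversely** (BCDT 2001, §2.2,
  "twisting by a quadratic character"; Silverman *AEC* X.5 Cor. 5.4).

Deliberately NOT here: anything about modularity of twists, conductors of twists, or the
`L`-function.  `lean search` for `isTorsionGaloisRep.*[tT]wist`, `quadraticTwist.*IsTorsionGaloisRep`
found nothing (2026-08-17).

## References

* [SilvermanAEC2009] J. H. Silverman, *The Arithmetic of Elliptic Curves*, 2nd ed., X.5 Cor. 5.4,
  X.2 Prop. 2.4.
* [BCDTJAMS2001] C. Breuil, B. Conrad, F. Diamond, R. Taylor, J. Amer. Math. Soc. 14 (2001),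
  §2.2 (proof of Thm. 2.2.1, p. 860: twisting `ρ̄` by a quadratic character).
-/

noncomputable section

open scoped MatrixGroups Classical
open Field Matrix
open Literature.NumberTheory.GaloisRepresentations

universe u

/-! ## The isomorphism `E^{(d)}(F̄) ≃+ E(F̄)` with its sign keyed to `√d` -/

namespace WeierstrassCurve

open Literature.NumberTheory.EllipticCurves

/-- **`E^{(d)}(F̄) ≃+ E(F̄)`, equivariant up to the sign `σ√d/√d`** (Silverman *AEC* X.5
Cor. 5.4(iii), X.2 Prop. 2.4).  For a Weierstrass equation `W` over a field `F` with `2 ≠ 0` and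
`d ∈ F^*` there is an additive isomorphism `f : E^{(d)}(F̄) ≃+ E(F̄)` with `f(σP) = σ f(P)` for
every `σ ∈ Γ_F` fixing `√d` and `f(σP) = -σ f(P)` for every `σ` with `σ√d = -√d`.  Verbatim the
construction of the tree's `exists_addEquiv_geomPoints_quadraticTwist_signed`
(`OpenImageMazurTwistProofs`) / `exists_addEquiv_geomPoints_quadraticTwist`
(`TateModuleTwistTransportProofs`): `W^{(d)} = W₀^{(d)}` for the model `W₀ = W.toCharNeTwoNF • W`
with `a₁ = a₃ = 0` (`quadraticTwist_smul`), the untwisting `(x, y) ↦ (x/d, y/d√d)`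
(`untwistEquiv`, `untwistEquiv_smul_of_eq` / `untwistEquiv_smul_of_eq_neg`) and the change of
variables `W(F̄) ≃+ W₀(F̄)` (`VariableChange.pointEquivBaseChange`, `Γ_F`-equivariant) — here with
the two cases recorded against `σ√d = ±√d` rather than as a bare dichotomy.  Deliberate
dot-notation extension of Mathlib's `WeierstrassCurve` namespace, next to its two siblings.
[cite: SilvermanAEC2009, X.5 Cor. 5.4 and X.2 Prop. 2.4] -/
theorem exists_addEquiv_geomPoints_quadraticTwist_sqrt {K : Type u} [Field K] [NeZero (2 : K)]
    (W : WeierstrassCurve K) {d : K} (hd : d ≠ 0) :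
    ∃ f : (W.quadraticTwist d).geomPoints ≃+ W.geomPoints,
      ∀ σ : absoluteGaloisGroup K,
        (σ • geomSqrt d = geomSqrt d → ∀ P, f (σ • P) = σ • f P) ∧
        (σ • geomSqrt d = -geomSqrt d → ∀ P, f (σ • P) = -(σ • f P)) := by
  -- adapted from `exists_addEquiv_geomPoints_quadraticTwist_signed` (OpenImageMazurTwistProofs)
  letI : Invertible (2 : K) := invertibleOfNonzero two_ne_zero
  set C : VariableChange K := W.toCharNeTwoNF with hC
  set V : WeierstrassCurve K := C • W with hV
  haveI : V.IsCharNeTwoNF := by rw [hV, hC]; infer_instance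
  have hVW : W.quadraticTwist d = V.quadraticTwist d := by
    rw [hV, quadraticTwist_smul]
    have h1 : (⟨C.u, d * C.r, 0, 0⟩ : VariableChange K) = 1 := by
      simp only [hC, toCharNeTwoNF, mul_zero]
      rfl
    rw [h1, one_smul]
  let e₁ : (W.quadraticTwist d).geomPoints ≃+ (V.quadraticTwist d).geomPoints :=
    Affine.Point.congrEquiv
      (congrArg (fun Z : WeierstrassCurve K ↦ Z.baseChange (AlgebraicClosure K)) hVW)
  let e₂ : (V.quadraticTwist d).geomPoints ≃+ V.geomPoints := untwistEquiv V hd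
  let e₃ : V.geomPoints ≃+ W.geomPoints :=
    (VariableChange.pointEquivBaseChange W C (AlgebraicClosure K)).symm
  refine ⟨(e₁.trans e₂).trans e₃, fun σ ↦ ?_⟩
  have h₁ : ∀ P, e₁ (σ • P) = σ • e₁ P := fun P ↦
    congrEquiv_smul_of_eq hVW (absoluteGaloisGroup.toAlgEquiv K σ) P
  have h₃ : ∀ Q : V.geomPoints, e₃ (σ • Q) = σ • e₃ Q := by
    intro Q
    apply (VariableChange.pointEquivBaseChange W C (AlgebraicClosure K)).injective
    change VariableChange.pointEquivBaseChange W C (AlgebraicClosure K)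
        ((VariableChange.pointEquivBaseChange W C (AlgebraicClosure K)).symm
          (Affine.Point.map ((absoluteGaloisGroup.toAlgEquiv K σ : _) :
            AlgebraicClosure K →ₐ[K] AlgebraicClosure K) Q)) =
      VariableChange.pointEquivBaseChange W C (AlgebraicClosure K)
        (Affine.Point.map ((absoluteGaloisGroup.toAlgEquiv K σ : _) :
            AlgebraicClosure K →ₐ[K] AlgebraicClosure K)
          ((VariableChange.pointEquivBaseChange W C (AlgebraicClosure K)).symm Q))
    rw [AddEquiv.apply_symm_apply, VariableChange.pointEquivBaseChange_map_algEquiv,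
      AddEquiv.apply_symm_apply]
  refine ⟨fun hσ P ↦ ?_, fun hσ P ↦ ?_⟩
  · simp only [AddEquiv.trans_apply]
    rw [h₁, untwistEquiv_smul_of_eq V hd σ hσ (e₁ P), h₃]
  · simp only [AddEquiv.trans_apply]
    rw [h₁, untwistEquiv_smul_of_eq_neg V hd σ hσ (e₁ P), map_neg, h₃]

end WeierstrassCurve

namespace Literature.NumberTheory.EllipticCurves

open _root_.WeierstrassCurve

/-! ## The quadratic character of `F(√c)/F` as a continuous character -/

/-- **The quadratic character of `F(√c)/F` is continuous.**  For `c ≠ 0` (and `2 ≠ 0`) and any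
topological commutative ring `k` there is a continuous homomorphism `χ : Γ_F →ₜ* kˣ` with
`χ(σ) = 1` if `σ√c = √c`, `χ(σ) = -1` if `σ√c = -√c` (so `χ(σ) = ±1` for all `σ`).  The
homomorphism is the tree's `exists_quadraticCharacter`; it is constant on the left cosets of the
open subgroup `Γ_{F(√c)} = Stab(√c)` (`isOpen_stabilizer_geomSqrt`), hence locally constant, hence
continuous (for any topology on `kˣ`). [folklore] -/
theorem exists_continuousQuadraticCharacter {F : Type u} [Field F] [NeZero (2 : F)] {c : F}
    (hc : c ≠ 0) (k : Type*) [CommRing k] [TopologicalSpace k] :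
    ∃ χ : absoluteGaloisGroup F →ₜ* kˣ,
      (∀ σ, σ • geomSqrt c = geomSqrt c → χ σ = 1) ∧
      (∀ σ, σ • geomSqrt c = -geomSqrt c → χ σ = -1) ∧
      (∀ σ, χ σ = 1 ∨ χ σ = -1) := by
  obtain ⟨χ₀, h1, h2, h3⟩ := exists_quadraticCharacter hc k
  -- `χ₀` is constant on the cosets `σ₀ · Stab(√c)`
  have hlc : IsLocallyConstant χ₀ := by
    refine (IsLocallyConstant.iff_exists_open χ₀).mpr fun σ₀ ↦ ?_
    refine ⟨{σ | σ₀⁻¹ * σ ∈ MulAction.stabilizer (absoluteGaloisGroup F) (geomSqrt c)}, ?_, ?_, ?_⟩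
    · exact (isOpen_stabilizer_geomSqrt c).preimage (continuous_const_mul σ₀⁻¹)
    · simp only [Set.mem_setOf_eq, inv_mul_cancel]
      exact (MulAction.stabilizer (absoluteGaloisGroup F) (geomSqrt c)).one_mem
    · intro σ hσ
      simp only [Set.mem_setOf_eq, MulAction.mem_stabilizer_iff] at hσ
      have hmul : χ₀ σ = χ₀ σ₀ * χ₀ (σ₀⁻¹ * σ) := by rw [← map_mul, mul_inv_cancel_left]
      rw [hmul, h1 _ hσ, mul_one]
  exact ⟨⟨χ₀, hlc.continuous⟩, h1, h2, h3⟩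

/-! ## Transport of framed models along a signed-equivariant isomorphism -/

/-- **Framed models of the `p`-torsion transport along an isomorphism equivariant up to a sign
character, picking up the twist.**  Let `f : E'(F̄) ≃+ E(F̄)` be additive and, for a continuous
character `χ : Γ_F → {±1} ⊂ 𝔽_pˣ`, satisfy `f(σP) = σ f(P)` whenever `χ(σ) = 1` and
`f(σP) = -σ f(P)` whenever `χ(σ) = -1`.  If `e : E[p] ≃ 𝔽_p²` is a frame in which `Γ_F` acts by
`ρ̄` (`W.IsTorsionGaloisRep p ρ̄`), then `e ∘ f` frames `E'[p]` with `Γ_F` acting by `ρ̄ ⊗ χ`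
(`FramedRep.twist`: `(ρ̄ ⊗ χ)(σ) = χ(σ) ρ̄(σ)`): `e(f(σP)) = e(χ(σ) σ f P) = χ(σ) ρ̄(σ) e(f P)`.
[cite: SilvermanAEC2009, X.5 Cor. 5.4] -/
theorem isTorsionGaloisRep_twist_of_addEquiv_signed {F : Type u} [Field F]
    {W W' : WeierstrassCurve F} {p : ℕ} [Fact p.Prime] (f : W'.geomPoints ≃+ W.geomPoints)
    (χ : absoluteGaloisGroup F →ₜ* (ZMod p)ˣ)
    (hf : ∀ σ : absoluteGaloisGroup F,
      (χ σ = 1 ∧ ∀ P, f (σ • P) = σ • f P) ∨ (χ σ = -1 ∧ ∀ P, f (σ • P) = -(σ • f P)))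
    {ρ : ModPGaloisRep F (ZMod p) 2} (hρ : W.IsTorsionGaloisRep p ρ) :
    W'.IsTorsionGaloisRep p (FramedRep.twist ρ χ) := by
  obtain ⟨e, he⟩ := hρ
  -- restriction of `f` to the `p`-torsion
  have htor : ∀ {P : geomPoints W'}, P ∈ geomTorsion W' p ↔ f P ∈ geomTorsion W p := by
    intro P
    rw [geomTorsion, geomTorsion, AddSubgroup.torsionBy.nsmul_iff, AddSubgroup.torsionBy.nsmul_iff,
      ← map_nsmul, AddEquiv.map_eq_zero_iff]
  let fₚ : geomTorsion W' p ≃+ geomTorsion W p :=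
    { toFun := fun P ↦ ⟨f P, htor.mp P.2⟩
      invFun := fun Q ↦ ⟨f.symm Q, by rw [htor, f.apply_symm_apply]; exact Q.2⟩
      left_inv := fun P ↦ Subtype.ext (f.symm_apply_apply _)
      right_inv := fun Q ↦ Subtype.ext (f.apply_symm_apply _)
      map_add' := fun P Q ↦ Subtype.ext (by
        change f ((P : geomPoints W') + Q) = f P + f Q
        exact map_add f _ _) }
  have hfₚ : ∀ P : geomTorsion W' p, ((fₚ P : geomTorsion W p) : geomPoints W) = f P :=
    fun _ ↦ rfl
  refine ⟨fₚ.trans e, fun σ P ↦ ?_⟩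
  rw [AddEquiv.trans_apply, AddEquiv.trans_apply]
  rcases hf σ with ⟨hχ, hP⟩ | ⟨hχ, hP⟩
  · -- `χ σ = 1`: `f` commutes with `σ`, and `(ρ ⊗ χ)(σ) = ρ(σ)`
    have h1 : fₚ (σ • P) = σ • fₚ P := Subtype.ext (by
      rw [AddSubgroup.torsionBy.coe_smul, hfₚ, hfₚ, AddSubgroup.torsionBy.coe_smul, hP])
    rw [h1, he, FramedRep.twist_apply_of_eq_one ρ χ hχ]
  · -- `χ σ = -1`: `f` anticommutes with `σ`, and `(ρ ⊗ χ)(σ) = -ρ(σ)`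
    have h1 : fₚ (σ • P) = -(σ • fₚ P) := Subtype.ext (by
      rw [AddSubgroup.coe_neg, AddSubgroup.torsionBy.coe_smul, hfₚ, hfₚ,
        AddSubgroup.torsionBy.coe_smul, hP])
    rw [h1, map_neg, he, FramedRep.twist_apply_of_eq_neg_one ρ χ hχ, Units.val_neg,
      Matrix.neg_mulVec]

/-! ## Framed models of `E^{(d)}[p]` -/

/-- **If `ρ̄` is a framed model of `E[p]` then `ρ̄ ⊗ χ_d` is a framed model of `E^{(d)}[p]`**
(`χ_d` any continuous `{±1}`-valued character of `Γ_F` cutting out `σ√d/√d`; Silverman *AEC* X.5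
Cor. 5.4: `E^{(d)} ≅ E` over `F(√d)`, the cocycle being `χ_d`; BCDT 2001 §2.2).
`exists_addEquiv_geomPoints_quadraticTwist_sqrt` + `isTorsionGaloisRep_twist_of_addEquiv_signed`.
[cite: SilvermanAEC2009, X.5 Cor. 5.4] -/
theorem isTorsionGaloisRep_quadraticTwist_twist {F : Type u} [Field F] [NeZero (2 : F)]
    {W : WeierstrassCurve F} {d : F} (hd : d ≠ 0) {p : ℕ} [Fact p.Prime]
    (χ : absoluteGaloisGroup F →ₜ* (ZMod p)ˣ)
    (hχ₁ : ∀ σ, σ • geomSqrt d = geomSqrt d → χ σ = 1)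
    (hχ₂ : ∀ σ, σ • geomSqrt d = -geomSqrt d → χ σ = -1)
    {ρ : ModPGaloisRep F (ZMod p) 2} (hρ : W.IsTorsionGaloisRep p ρ) :
    (W.quadraticTwist d).IsTorsionGaloisRep p (FramedRep.twist ρ χ) := by
  obtain ⟨f, hf⟩ := W.exists_addEquiv_geomPoints_quadraticTwist_sqrt hd
  refine isTorsionGaloisRep_twist_of_addEquiv_signed f χ (fun σ ↦ ?_) hρ
  rcases smul_geomSqrt_eq_or σ d with hσ | hσ
  · exact Or.inl ⟨hχ₁ σ hσ, (hf σ).1 hσ⟩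
  · exact Or.inr ⟨hχ₂ σ hσ, (hf σ).2 hσ⟩

/-- **Conversely, if `ρ̄'` is a framed model of `E^{(d)}[p]` then `ρ̄' ⊗ χ_d` is a framed model of
`E[p]`**: the inverse `E(F̄) ≃+ E^{(d)}(F̄)` of the isomorphism of
`exists_addEquiv_geomPoints_quadraticTwist_sqrt` is equivariant up to the same sign.
[cite: SilvermanAEC2009, X.5 Cor. 5.4] -/
theorem isTorsionGaloisRep_of_quadraticTwist_twist {F : Type u} [Field F] [NeZero (2 : F)]
    {W : WeierstrassCurve F} {d : F} (hd : d ≠ 0) {p : ℕ} [Fact p.Prime]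
    (χ : absoluteGaloisGroup F →ₜ* (ZMod p)ˣ)
    (hχ₁ : ∀ σ, σ • geomSqrt d = geomSqrt d → χ σ = 1)
    (hχ₂ : ∀ σ, σ • geomSqrt d = -geomSqrt d → χ σ = -1)
    {ρ' : ModPGaloisRep F (ZMod p) 2} (hρ' : (W.quadraticTwist d).IsTorsionGaloisRep p ρ') :
    W.IsTorsionGaloisRep p (FramedRep.twist ρ' χ) := by
  obtain ⟨f, hf⟩ := W.exists_addEquiv_geomPoints_quadraticTwist_sqrt hd
  -- the inverse is signed-equivariant with the same signs
  have hf' : ∀ σ : absoluteGaloisGroup F,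
      (σ • geomSqrt d = geomSqrt d → ∀ Q, f.symm (σ • Q) = σ • f.symm Q) ∧
      (σ • geomSqrt d = -geomSqrt d → ∀ Q, f.symm (σ • Q) = -(σ • f.symm Q)) := by
    intro σ
    refine ⟨fun hσ Q ↦ ?_, fun hσ Q ↦ ?_⟩
    · apply f.injective
      rw [f.apply_symm_apply, (hf σ).1 hσ, f.apply_symm_apply]
    · apply f.injective
      rw [f.apply_symm_apply, map_neg, (hf σ).2 hσ, f.apply_symm_apply, neg_neg]
  refine isTorsionGaloisRep_twist_of_addEquiv_signed f.symm χ (fun σ ↦ ?_) hρ'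
  rcases smul_geomSqrt_eq_or σ d with hσ | hσ
  · exact Or.inl ⟨hχ₁ σ hσ, (hf' σ).1 hσ⟩
  · exact Or.inr ⟨hχ₂ σ hσ, (hf' σ).2 hσ⟩

/-- **`E[p] ≅ ρ̄` iff `E^{(d)}[p] ≅ ρ̄ ⊗ χ_d`**, packaged with the existence of the continuous
quadratic character `χ_d : Γ_F →ₜ* 𝔽_pˣ` of `F(√d)/F` (`exists_continuousQuadraticCharacter`;
`χ_d² = 1`, so twisting twice is the identity, `FramedRep.twist_twist`, `FramedRep.twist_one`).
[cite: SilvermanAEC2009, X.5 Cor. 5.4] [cite: BCDTJAMS2001, §2.2 (proof of Thm. 2.2.1, p. 860)] -/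
theorem exists_quadraticCharacter_isTorsionGaloisRep_quadraticTwist_iff {F : Type u} [Field F]
    [NeZero (2 : F)] (W : WeierstrassCurve F) {d : F} (hd : d ≠ 0) (p : ℕ) [Fact p.Prime] :
    ∃ χ : absoluteGaloisGroup F →ₜ* (ZMod p)ˣ,
      (∀ σ, σ • geomSqrt d = geomSqrt d → χ σ = 1) ∧
      (∀ σ, σ • geomSqrt d = -geomSqrt d → χ σ = -1) ∧
      (∀ σ, χ σ = 1 ∨ χ σ = -1) ∧
      ∀ ρ : ModPGaloisRep F (ZMod p) 2,
        W.IsTorsionGaloisRep p ρ ↔ (W.quadraticTwist d).IsTorsionGaloisRep p (FramedRep.twist ρ χ) := by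
  obtain ⟨χ, h1, h2, h3⟩ := exists_continuousQuadraticCharacter hd (ZMod p)
  refine ⟨χ, h1, h2, h3, fun ρ ↦ ⟨isTorsionGaloisRep_quadraticTwist_twist hd χ h1 h2, fun h ↦ ?_⟩⟩
  have hsq : ∀ σ, χ σ ^ 2 = 1 := fun σ ↦ by
    rcases h3 σ with h | h <;> rw [h]
    · exact one_pow 2
    · exact neg_one_sq
  have hχχ : χ * χ = 1 := ContinuousMonoidHom.ext fun g ↦ by
    rw [ContinuousMonoidHom.mul_apply, ← sq, hsq]; rfl
  have h' := isTorsionGaloisRep_of_quadraticTwist_twist hd χ h1 h2 h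
  rwa [FramedRep.twist_twist, hχχ, FramedRep.twist_one] at h'

end Literature.NumberTheory.EllipticCurves

end
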